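import Summits.HodgeConjecture.HodgeConjecture.Theorems.EightfoldBlochSeedsChernCharacterOnBettiAnalytificationExists
import HarnessLib

/-!
# K1 (analytification bridge), step 3: the integral Betti Chern classes `cᵢ(F(ℂ)) ∈ H²ⁱ(X(ℂ); ℤ)` of an
# algebraic vector bundle — they exist and die on every trivialising Zariski open (coniveau `≥ 1`)

Route `EightfoldBlochSeeds` / item `stmt-HodgeConjecture-19780` (`ChernCharacterOnBetti`), helper
(`--supports`). HONEST FRAMING: nothing here proves 19780 / 18880 / 18882 / 18883 / H2 / HC_AV / HC;
no definition, no named fact.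

WHAT. A TOPOLOGICAL COMPARISON DATUM for an `𝒪_X`-module `F` on the complex points `X(ℂ)` is a
complex vector bundle `E` on `X(ℂ)` (`CharacteristicClasses.ComplexVectorBundle`) with maps
`α_U : Γ(F, U) → sections of E` that are continuous on `U(ℂ)` and carry algebraic frames of `F`
over `U` to fibrewise bases on `U(ℂ)` (Serre's `α : F' → F^h`, GAGA §3 n°9, read topologically;
existence for `F` locally free of rank `r`: `exists_topologicalAnalytification`). For such a datum
on a smooth projective `X`:

* `chernClassZ_restrictToOpen_eq_zero_of_comparison` — `cᵢ(E)|_{U(ℂ)} = 0` in `H²ⁱ(U(ℂ); ℤ)` for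
  every Zariski open `U` carrying an algebraic frame of `F` and every `i ≥ 1` (the algebraic frame is
  a continuous frame of `E` over `U(ℂ)`; `HodgeTheory.chernClassZ_restrictToCompl_eq_zero_of_frame`);
* `chernClassZ_mem_coniveauFiltration_one_of_comparison` — hence `cᵢ(E) ∈ N¹ H²ⁱ(X(ℂ); ℤ)` as soon
  as `F` has a frame over ONE non-empty open (Bloch–Ogus coniveau);
* `exists_analytification_chernClassZ` — **packaged with existence**: an algebraic vector bundle
  `F` of rank `r` (frames everywhere) on a smooth projective `X` HAS a topological analytification
  `(E, α)` of rank `r`, and its integral Chern classes `cᵢ(E) = chernClassZ E i ∈ H²ⁱ(X(ℂ); ℤ)` —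
  the tree's `CharacteristicClasses.chernClassR ℤ` (Grothendieck/Husemoller) — restrict to zero
  over every trivialising open and lie in `N¹` for `i ≥ 1`.

What remains for `ChernCharacterOnBetti` after this (census in the seat's HOME STATUS): independence
of `cᵢ` from the datum (bundle isomorphism from `IsAnalytifiedHom`-uniqueness), functoriality in
`X`, additivity on short exact sequences, `ringChange ℤ → ℂ` of `chernClassR` (rationality in
`complexBetti`), `ch` from `c` (Newton), and the two cycle-class laws (`Nⁱ`, span).
[cite: SerreGAGA1956, §3 n°9 Déf. 2 and §4 n°20] [cite: HusemollerFibreBundles1994, Ch. 17 §3 (C₁) and Prop. 4.1]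
[cite: BlochOgus1974ENS, (3.8)]
-/

noncomputable section

-- single-problem summit (Problem = Summit): the mandated namespace repeats `HodgeConjecture`.
set_option linter.dupNamespace false

open CategoryTheory AlgebraicGeometry Bundle Topology
open Literature.AlgebraicGeometry.Motives Literature.AlgebraicGeometry.HodgeTheory
open Literature.AlgebraicTopology.SingularHomology Literature.AlgebraicTopology.CharacteristicClasses

namespace Summit.HodgeConjecture.HodgeConjecture.Theorems

variable {n : ℕ} {X : SchemeOver ℂ} {F : X.left.Modules} {r : ℕ}

/-- **Chern classes of a topological analytification die on every trivialising open, integrally.**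
For `X` smooth projective, a bundle `E` on `X(ℂ)` with comparison maps `α` (continuous on `U(ℂ)`,
frames ↦ bases) for the `𝒪_X`-module `F`, and an algebraic frame `t` of `F` over `U`:
`cᵢ(E)|_{U(ℂ)} = 0` in `H²ⁱ(U(ℂ); ℤ)`, `i ≥ 1`. [cite: HusemollerFibreBundles1994, Ch. 17 §3 (C₁) and Prop. 4.1]
[cite: SerreGAGA1956, §4 n°20] -/
theorem chernClassZ_restrictToOpen_eq_zero_of_comparison (hX : IsSmoothProjective n X)
    (E : ComplexVectorBundle.{0, 0} (ComplexPoints X))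
    (α : ∀ U : X.left.Opens, Γ(F, U) → ∀ P : ComplexPoints X, E.E P)
    (hcont : ∀ (U : X.left.Opens) (σ : Γ(F, U)),
      ContinuousOn (fun P ↦ (⟨P, α U σ P⟩ : TotalSpace E.F E.E)) {P | P.pt ∈ U})
    (hframe : ∀ (U : X.left.Opens) (t : Fin r → Γ(F, U)), IsSectionFrame F U t →
      ∀ P : ComplexPoints X, P.pt ∈ U → LinearIndependent ℂ (fun j ↦ α U (t j) P) ∧
        ⊤ ≤ Submodule.span ℂ (Set.range fun j ↦ α U (t j) P))
    {U : X.left.Opens} {t : Fin r → Γ(F, U)} (ht : IsSectionFrame F U t) {i : ℕ} (hi : 0 < i) :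
    restrictToCompl ℤ X (2 * i) ((U : Set X.left)ᶜ) (chernClassZ E i) = 0 := by
  refine chernClassZ_restrictToCompl_eq_zero_of_frame hX E U.2.isClosed_compl
    (fun j P ↦ α U (t j) P.1) (fun j ↦ ?_)
    (fun P ↦ hframe U t ht P.1 (Set.notMem_compl_iff.1 P.2)) hi
  exact (hcont U (t j)).comp_continuous continuous_subtype_val
    fun P ↦ Set.notMem_compl_iff.1 P.2

/-- **Hence `cᵢ(E) ∈ N¹ H²ⁱ(X(ℂ); ℤ)`** (`i ≥ 1`) as soon as `F` has an algebraic frame over one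
non-empty Zariski open. [cite: BlochOgus1974ENS, (3.8)] [cite: SerreGAGA1956, §4 n°20] -/
theorem chernClassZ_mem_coniveauFiltration_one_of_comparison (hX : IsSmoothProjective n X)
    (E : ComplexVectorBundle.{0, 0} (ComplexPoints X))
    (α : ∀ U : X.left.Opens, Γ(F, U) → ∀ P : ComplexPoints X, E.E P)
    (hcont : ∀ (U : X.left.Opens) (σ : Γ(F, U)),
      ContinuousOn (fun P ↦ (⟨P, α U σ P⟩ : TotalSpace E.F E.E)) {P | P.pt ∈ U})
    (hframe : ∀ (U : X.left.Opens) (t : Fin r → Γ(F, U)), IsSectionFrame F U t →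
      ∀ P : ComplexPoints X, P.pt ∈ U → LinearIndependent ℂ (fun j ↦ α U (t j) P) ∧
        ⊤ ≤ Submodule.span ℂ (Set.range fun j ↦ α U (t j) P))
    {U : X.left.Opens} (hU : (U : Set X.left).Nonempty) {t : Fin r → Γ(F, U)}
    (ht : IsSectionFrame F U t) {i : ℕ} (hi : 0 < i) :
    chernClassZ E i ∈ coniveauFiltration ℤ X (2 * i) 1 := by
  haveI := IsSmoothProjective.isIntegral_holds hX
  obtain ⟨x, hx⟩ := hU
  have hne : ((U : Set X.left)ᶜ) ≠ Set.univ := fun h ↦ (h ▸ Set.mem_univ x : x ∈ (U : Set X.left)ᶜ) hx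
  exact (exists_ne_univ_restrictToCompl_eq_zero_iff_mem_coniveauFiltration_one ℤ _).1
    ⟨(U : Set X.left)ᶜ, U.2.isClosed_compl, hne,
      chernClassZ_restrictToOpen_eq_zero_of_comparison hX E α hcont hframe ht hi⟩

/-- **K1 packaged: the integral Betti Chern classes of an algebraic vector bundle exist and are
generically trivial.** For `X` smooth projective over `ℂ` and an `𝒪_X`-module `F` locally free of
rank `r` (every point in a Zariski open with an algebraic frame of size `r`): there is a topological
analytification `(E, α)` of rank `r` on `X(ℂ)` (Serre's `F^h` with its comparison map, topologically:
additive, `𝒪_X`-linear, restriction-compatible, continuous, frames ↦ bases), and for every Zariski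
open `U` carrying a frame and every `i ≥ 1` the Chern class `cᵢ(E) = chernClassZ E i ∈ H²ⁱ(X(ℂ); ℤ)`
(Husemoller Ch. 17, the tree's `chernClassR ℤ`) restricts to `0` on `U(ℂ)` and lies in
`N¹ H²ⁱ(X(ℂ); ℤ)` when `U ≠ ∅`. [cite: SerreGAGA1956, §3 n°9 Déf. 2 and §4 n°20]
[cite: HusemollerFibreBundles1994, Ch. 17 Def. 2.6, §3 (C₁) and Prop. 4.1] [cite: BlochOgus1974ENS, (3.8)] -/
theorem exists_analytification_chernClassZ (hX : IsSmoothProjective n X)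
    (hF : ∀ x : X.left, ∃ (U : X.left.Opens) (s : Fin r → Γ(F, U)), x ∈ U ∧ IsSectionFrame F U s) :
    ∃ (E : ComplexVectorBundle.{0, 0} (ComplexPoints X))
      (α : ∀ U : X.left.Opens, Γ(F, U) → ∀ P : ComplexPoints X, E.E P),
      E.rank = r ∧
      (∀ (U : X.left.Opens) (σ τ : Γ(F, U)) (P : ComplexPoints X),
          α U (σ + τ) P = α U σ P + α U τ P) ∧
      (∀ (U : X.left.Opens) (f : Γ(X.left, U)) (σ : Γ(F, U)) (P : ComplexPoints X) (h : P.pt ∈ U),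
          α U (f • σ) P = P.eval U h f • α U σ P) ∧
      (∀ (U W : X.left.Opens) (hWU : W ≤ U) (σ : Γ(F, U)) (P : ComplexPoints X), P.pt ∈ W →
          α W (F.presheaf.map (homOfLE hWU).op σ) P = α U σ P) ∧
      (∀ (U : X.left.Opens) (σ : Γ(F, U)),
          ContinuousOn (fun P ↦ (⟨P, α U σ P⟩ : TotalSpace E.F E.E)) {P | P.pt ∈ U}) ∧
      (∀ (U : X.left.Opens) (t : Fin r → Γ(F, U)), IsSectionFrame F U t → ∀ P : ComplexPoints X,
          P.pt ∈ U → LinearIndependent ℂ (fun j ↦ α U (t j) P) ∧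
            ⊤ ≤ Submodule.span ℂ (Set.range fun j ↦ α U (t j) P)) ∧
      (∀ (U : X.left.Opens) (t : Fin r → Γ(F, U)), IsSectionFrame F U t → ∀ i : ℕ, 0 < i →
          restrictToCompl ℤ X (2 * i) ((U : Set X.left)ᶜ) (chernClassZ E i) = 0 ∧
          ((U : Set X.left).Nonempty → chernClassZ E i ∈ coniveauFiltration ℤ X (2 * i) 1)) := by
  obtain ⟨E, α, hrank, hadd, hsmul, hres, hcont, hframe⟩ := exists_topologicalAnalytification hF
  exact ⟨E, α, hrank, hadd, hsmul, hres, hcont, hframe, fun U t ht i hi ↦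
    ⟨chernClassZ_restrictToOpen_eq_zero_of_comparison hX E α hcont hframe ht hi, fun hU ↦
      chernClassZ_mem_coniveauFiltration_one_of_comparison hX E α hcont hframe hU ht hi⟩⟩

end Summit.HodgeConjecture.HodgeConjecture.Theorems

end
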